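import Mathlib
import Literature.Computability.Complexity.RangeAvoidance
import Literature.Computability.Complexity.SignDegreeXor
import Summits.PneNP.PneNP.Theorems.IP3ExpandingModel
import Summits.PneNP.PneNP.Theorems.IP3ExpandingExist

/-!
# Random pure `IP₃` instances at ratio `15/4`, II: few output pairs share two variables (cell `pnp-ideate`, w23e)

FRONTIER range-avoidance ladder, rung F-N3 context (restricted-model combinatorics — nothing here bears on `P` vs `NP`).

`PstarSALevel.SimpleOverlap` (no two outputs share two variables) is a hypothesis of the pairwise SA+SDP hub
`PairwiseSA.pairwiseSASDPLinearLevel`.  In the model `IP3ExpandingModel.Outcome6 N m` (every output an injective `6`-tuple of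
positions) two outputs share two variables only if two DISTINCT slots of the second read values of the first: for a fixed tuple `e`
at most `1080·N⁴` tuples do (`card_ov6_le`: `30` ordered slot pairs, `36` value pairs, `N⁴` completions), against
`Q = |Fin 6 ↪ Fin N| ≥ N⁶/64` tuples in all (`IP3ExpandingExist.pow_six_le`, `N ≥ 10`).  Hence the number `#ovl6 ω` of output pairs
sharing two variables has total mass `Σ_ω #ovl6 ω ≤ C(m,2)·1080N⁴·Q·Q^{m−2}` (`sum_card_ovl6_le`), and MARKOV AS COUNTING
(`card_many6_mul_le`) gives `two_mul_card_many6_le`: with `m ≤ K·N`, at most half of the outcomes have more than `69120·K²` such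
pairs.  Part III (`IP3Expanding154Exist`) intersects this with the expansion count; part IV deletes one output per bad pair.
-/

set_option linter.dupNamespace false

open Finset Literature.Computability.Complexity
open Summit.PneNP.PneNP.Theorems.PstarSALevel (varSet)
open Summit.PneNP.PneNP.Theorems.IP3ExpandingModel
open Summit.PneNP.PneNP.Theorems.IP3ExpandingExist (pow_six_le)

namespace Summit.PneNP.PneNP.Theorems.IP3OverlapCount

variable {N m : ℕ}

/-! ## Tuples sharing two values with a fixed one -/

/-- The variable set of output `j` of `inst6 ω` is the range of its tuple. -/
theorem varSet_inst6 (ω : Outcome6 N m) (j : Fin m) : varSet (inst6 ω) j = univ.image (ω j) := rfl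

/-- The tuples reading `a` at slot `s₁` and `b` at slot `s₂`. -/
noncomputable def pin2 (s₁ s₂ : Fin 6) (a b : Fin N) : Finset (Fin 6 ↪ Fin N) := univ.filter fun e' => e' s₁ = a ∧ e' s₂ = b

/-- At most `N⁴` tuples have two prescribed values at two distinct slots. -/
theorem card_pin2_le {s₁ s₂ : Fin 6} (hs : s₁ ≠ s₂) (a b : Fin N) : (pin2 s₁ s₂ a b).card ≤ N ^ 4 := by
  classical
  have h : (pin2 s₁ s₂ a b).card ≤
      (Fintype.piFinset fun s : Fin 6 => if s = s₁ then ({a} : Finset (Fin N)) else if s = s₂ then {b} else univ).card := by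
    refine card_le_card_of_injOn (fun e => (e : Fin 6 → Fin N)) ?_ ?_
    · intro e he
      simp only [pin2, coe_filter, Set.mem_setOf_eq, mem_univ, true_and] at he
      rw [mem_coe, Fintype.mem_piFinset]
      intro s
      by_cases h1 : s = s₁
      · subst h1; simp [he.1]
      · by_cases h2 : s = s₂
        · subst h2; simp [h1, he.2]
        · simp [h1, h2]
    · intro e _ e' _ h
      exact DFunLike.coe_injective h
  refine h.trans ?_
  rw [Fintype.card_piFinset]
  have hc : ∀ s : Fin 6, (if s = s₁ then ({a} : Finset (Fin N)) else if s = s₂ then {b} else univ).card =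
      if s ∈ ({s₁, s₂} : Finset (Fin 6)) then 1 else N := by
    intro s
    by_cases h1 : s = s₁
    · simp [h1]
    · by_cases h2 : s = s₂
      · simp [h2, hs.symm]
      · simp [h1, h2]
  simp_rw [hc]
  rw [prod_ite, prod_const_one, one_mul, prod_const]
  have hcard : (univ.filter fun s : Fin 6 => s ∉ ({s₁, s₂} : Finset (Fin 6))).card = 4 := by
    rw [filter_not, filter_mem_eq_inter, univ_inter, card_univ_sdiff, Fintype.card_fin, card_pair hs]
  rw [hcard]

/-- The tuples sharing at least two values with `e`. -/
noncomputable def ov6 (e : Fin 6 ↪ Fin N) : Finset (Fin 6 ↪ Fin N) :=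
  univ.filter fun e' => 2 ≤ ((univ : Finset (Fin 6)).image e ∩ univ.image e').card

/-- **At most `1080·N⁴` tuples share two values with a given one.** -/
theorem card_ov6_le (e : Fin 6 ↪ Fin N) : (ov6 e).card ≤ 1080 * N ^ 4 := by
  classical
  set S := (univ : Finset (Fin 6 × Fin 6)).filter (fun p => p.1 ≠ p.2) with hS
  set V := ((univ : Finset (Fin 6)).image e) ×ˢ ((univ : Finset (Fin 6)).image e) with hV
  have hsub : ov6 e ⊆ S.biUnion fun p => V.biUnion fun ab => pin2 p.1 p.2 ab.1 ab.2 := by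
    intro e' he'
    simp only [ov6, mem_filter, mem_univ, true_and] at he'
    obtain ⟨x, hx, y, hy, hxy⟩ := one_lt_card.1 he'
    rw [mem_inter] at hx hy
    obtain ⟨s₁, -, rfl⟩ := mem_image.1 hx.2
    obtain ⟨s₂, -, rfl⟩ := mem_image.1 hy.2
    have hs : s₁ ≠ s₂ := fun h => hxy (by rw [h])
    rw [mem_biUnion]
    refine ⟨(s₁, s₂), by simp [hS, hs], mem_biUnion.2 ⟨(e' s₁, e' s₂), ?_, ?_⟩⟩
    · rw [hV, mem_product]
      exact ⟨hx.1, hy.1⟩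
    · simp [pin2]
  refine (card_le_card hsub).trans (card_biUnion_le.trans ?_)
  have hSc : S.card ≤ 30 := by
    have : S.card ≤ (univ : Finset (Fin 6 × Fin 6)).card := card_le_card (filter_subset _ _)
    have h36 : (univ : Finset (Fin 6 × Fin 6)).card = 36 := by simp
    -- the diagonal has `6` elements
    have hdiag : ((univ : Finset (Fin 6 × Fin 6)).filter fun p => ¬ p.1 ≠ p.2).card = 6 := by decide
    have hsplit := card_filter_add_card_filter_not (s := (univ : Finset (Fin 6 × Fin 6))) (fun p => p.1 ≠ p.2)
    rw [hdiag, h36] at hsplit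
    rw [hS]; omega
  have hVc : V.card ≤ 36 := by
    rw [hV, card_product]
    have : ((univ : Finset (Fin 6)).image e).card ≤ 6 := card_image_le.trans (by simp)
    nlinarith
  have hp : ∀ p ∈ S, (V.biUnion fun ab => pin2 p.1 p.2 ab.1 ab.2).card ≤ 36 * N ^ 4 := by
    intro p hp
    rw [hS, mem_filter] at hp
    refine card_biUnion_le.trans ?_
    refine (sum_le_sum fun ab _ => card_pin2_le hp.2 ab.1 ab.2).trans ?_
    rw [sum_const, smul_eq_mul]
    exact Nat.mul_le_mul_right _ hVc
  refine (sum_le_sum hp).trans ?_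
  rw [sum_const, smul_eq_mul]
  calc S.card * (36 * N ^ 4) ≤ 30 * (36 * N ^ 4) := Nat.mul_le_mul_right _ hSc
    _ = 1080 * N ^ 4 := by ring

/-! ## Overlapping pairs of an outcome and their total number -/

/-- The output pairs `j < j'` of `inst6 ω` sharing at least two variables. -/
def ovl6 (ω : Outcome6 N m) : Finset (Fin m × Fin m) :=
  univ.filter fun p => p.1 < p.2 ∧ 2 ≤ (varSet (inst6 ω) p.1 ∩ varSet (inst6 ω) p.2).card

/-- The cylinder of outcomes with two prescribed tuples. -/
noncomputable def cyl2 (j j' : Fin m) (e e' : Fin 6 ↪ Fin N) : Finset (Outcome6 N m) :=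
  Fintype.piFinset fun i => if i = j then {e} else if i = j' then {e'} else univ

/-- Its size: `Q^{m−2}` for `j ≠ j'`. -/
theorem card_cyl2 {j j' : Fin m} (hjj' : j ≠ j') (e e' : Fin 6 ↪ Fin N) :
    (cyl2 j j' e e').card = Fintype.card (Fin 6 ↪ Fin N) ^ (m - 2) := by
  classical
  unfold cyl2
  rw [Fintype.card_piFinset]
  have h : ∀ i : Fin m, (if i = j then ({e} : Finset (Fin 6 ↪ Fin N)) else if i = j' then {e'} else univ).card =
      if i ∈ ({j, j'} : Finset (Fin m)) then 1 else Fintype.card (Fin 6 ↪ Fin N) := by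
    intro i
    by_cases h1 : i = j
    · simp [h1]
    · by_cases h2 : i = j'
      · simp [h2, hjj'.symm]
      · simp [h1, h2]
  simp_rw [h]
  rw [prod_ite, prod_const_one, one_mul, prod_const]
  congr 1
  rw [filter_not, filter_mem_eq_inter, univ_inter, card_univ_sdiff, Fintype.card_fin, card_pair hjj']

/-- The outcomes whose outputs `j ≠ j'` share two variables number at most `1080N⁴ · Q · Q^{m−2}`. -/
theorem card_overlap6_le {j j' : Fin m} (hjj' : j ≠ j') :
    (univ.filter fun ω : Outcome6 N m => 2 ≤ (varSet (inst6 ω) j ∩ varSet (inst6 ω) j').card).card ≤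
      1080 * N ^ 4 * Fintype.card (Fin 6 ↪ Fin N) * Fintype.card (Fin 6 ↪ Fin N) ^ (m - 2) := by
  classical
  have hsub : (univ.filter fun ω : Outcome6 N m => 2 ≤ (varSet (inst6 ω) j ∩ varSet (inst6 ω) j').card) ⊆
      (univ : Finset (Fin 6 ↪ Fin N)).biUnion fun e => (ov6 e).biUnion fun e' => cyl2 j j' e e' := by
    intro ω hω
    rw [mem_filter] at hω
    rw [mem_biUnion]
    refine ⟨ω j, mem_univ _, mem_biUnion.2 ⟨ω j', ?_, ?_⟩⟩
    · simp only [ov6, mem_filter, mem_univ, true_and]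
      have h2 := hω.2
      rw [varSet_inst6, varSet_inst6] at h2
      exact h2
    · unfold cyl2
      rw [Fintype.mem_piFinset]
      intro i
      by_cases h1 : i = j
      · subst h1; simp
      · by_cases h2 : i = j'
        · subst h2; simp [h1]
        · simp [h1, h2]
  refine (card_le_card hsub).trans (card_biUnion_le.trans ?_)
  have hq : ∀ e ∈ (univ : Finset (Fin 6 ↪ Fin N)), ((ov6 e).biUnion fun e' => cyl2 j j' e e').card ≤
      1080 * N ^ 4 * Fintype.card (Fin 6 ↪ Fin N) ^ (m - 2) := by
    intro e _
    refine card_biUnion_le.trans ?_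
    rw [sum_congr rfl fun e' _ => card_cyl2 hjj' e e', sum_const, smul_eq_mul]
    exact Nat.mul_le_mul_right _ (card_ov6_le e)
  refine (sum_le_sum hq).trans ?_
  rw [sum_const, smul_eq_mul, card_univ]
  ring_nf
  exact le_rfl

/-- **Total mass of overlapping pairs**: `Σ_ω #ovl6 ω ≤ C(m,2) · 1080N⁴ · Q · Q^{m−2}`. -/
theorem sum_card_ovl6_le :
    ∑ ω : Outcome6 N m, (ovl6 ω).card ≤
      m.choose 2 * (1080 * N ^ 4 * Fintype.card (Fin 6 ↪ Fin N) * Fintype.card (Fin 6 ↪ Fin N) ^ (m - 2)) := by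
  classical
  have h1 : ∀ ω : Outcome6 N m, (ovl6 ω).card =
      ∑ p ∈ (univ : Finset (Fin m × Fin m)).filter (fun p => p.1 < p.2),
        if 2 ≤ (varSet (inst6 ω) p.1 ∩ varSet (inst6 ω) p.2).card then 1 else 0 := by
    intro ω
    rw [ovl6, ← filter_filter, card_filter]
  simp_rw [h1]
  rw [sum_comm]
  have h2 : ∀ p ∈ (univ : Finset (Fin m × Fin m)).filter (fun p => p.1 < p.2),
      (∑ ω : Outcome6 N m, if 2 ≤ (varSet (inst6 ω) p.1 ∩ varSet (inst6 ω) p.2).card then 1 else 0) ≤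
        1080 * N ^ 4 * Fintype.card (Fin 6 ↪ Fin N) * Fintype.card (Fin 6 ↪ Fin N) ^ (m - 2) := by
    intro p hp
    rw [mem_filter] at hp
    rw [← card_filter]
    exact card_overlap6_le (ne_of_lt hp.2)
  refine (sum_le_sum h2).trans ?_
  rw [sum_const, smul_eq_mul]
  refine Nat.mul_le_mul_right _ ?_
  have h : ((univ : Finset (Fin m × Fin m)).filter fun p => p.1 < p.2).card ≤
      ((univ : Finset (Sym2 (Fin m))).filter fun b => ¬b.IsDiag).card := by
    refine card_le_card_of_injOn (fun p => s(p.1, p.2)) (fun p hp => ?_) (fun p hp p' hp' h => ?_)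
    · rw [mem_coe, mem_filter] at hp
      rw [mem_coe, mem_filter, Sym2.mk_isDiag_iff]
      exact ⟨mem_univ _, ne_of_lt hp.2⟩
    · rw [mem_coe, mem_filter] at hp hp'
      rcases Sym2.eq_iff.1 h with ⟨h1, h2⟩ | ⟨h1, h2⟩
      · exact Prod.ext h1 h2
      · exfalso
        have a1 := hp.2
        have a2 := hp'.2
        rw [h1, h2] at a1
        exact lt_asymm a1 a2
  refine h.trans (le_of_eq ?_)
  rw [← Fintype.card_subtype, Sym2.card_subtype_not_diag, Fintype.card_fin]

/-! ## Markov as counting -/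

/-- **Markov**: `#{ω : B < #ovl6 ω} · (B + 1) ≤ Σ_ω #ovl6 ω`. -/
theorem card_many6_mul_le (B : ℕ) :
    (univ.filter fun ω : Outcome6 N m => B < (ovl6 ω).card).card * (B + 1) ≤ ∑ ω : Outcome6 N m, (ovl6 ω).card := by
  classical
  rw [← smul_eq_mul, ← sum_const]
  calc ∑ ω ∈ univ.filter (fun ω : Outcome6 N m => B < (ovl6 ω).card), (B + 1)
      ≤ ∑ ω ∈ univ.filter (fun ω : Outcome6 N m => B < (ovl6 ω).card), (ovl6 ω).card :=
        sum_le_sum fun ω hω => (mem_filter.1 hω).2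
    _ ≤ ∑ ω : Outcome6 N m, (ovl6 ω).card :=
        sum_le_sum_of_subset_of_nonneg (filter_subset _ _) fun _ _ _ => Nat.zero_le _

/-- `N⁶ ≤ 64·Q` for `N ≥ 10`, in `ℕ`. -/
theorem pow_six_le_nat (hN : 10 ≤ N) : N ^ 6 ≤ 64 * Fintype.card (Fin 6 ↪ Fin N) := by
  have h := pow_six_le N hN
  exact_mod_cast h

/-- The number of outcomes is `Q^m`. -/
theorem card_Outcome6 : Fintype.card (Outcome6 N m) = Fintype.card (Fin 6 ↪ Fin N) ^ m := by
  rw [Fintype.card_fun, Fintype.card_fin]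

/-- **At most half of the outcomes have more than `69120K²` overlapping pairs** (`m ≤ K·N`, `N ≥ 10`):
`2 · #{ω : 69120K² < #ovl6 ω} ≤ #Outcome6`. -/
theorem two_mul_card_many6_le (K : ℕ) (hN : 10 ≤ N) (hm : m ≤ K * N) :
    2 * (univ.filter fun ω : Outcome6 N m => 69120 * K ^ 2 < (ovl6 ω).card).card ≤ Fintype.card (Outcome6 N m) := by
  classical
  set Q := Fintype.card (Fin 6 ↪ Fin N) with hQ
  set M := (univ.filter fun ω : Outcome6 N m => 69120 * K ^ 2 < (ovl6 ω).card).card with hM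
  have h1 := card_many6_mul_le (N := N) (m := m) (69120 * K ^ 2)
  have h2 := sum_card_ovl6_le (N := N) (m := m)
  have hQ6 := pow_six_le_nat hN
  rcases lt_or_ge m 2 with hm2 | hm2
  · have h0 : M = 0 := by
      rw [hM, card_eq_zero, filter_eq_empty_iff]
      intro ω _ hlt
      have hz : (ovl6 ω).card = 0 := by
        rw [card_eq_zero, ovl6, filter_eq_empty_iff]
        intro p _ hp
        have a := p.1.isLt
        have b := p.2.isLt
        have c := Fin.lt_def.1 hp.1
        omega
      omega
    rw [h0]; exact Nat.zero_le _
  · have hΩ : Fintype.card (Outcome6 N m) = Q * (Q * Q ^ (m - 2)) := by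
      rw [card_Outcome6, ← hQ, ← pow_succ', ← pow_succ']; congr 1; omega
    rw [hΩ]
    set T := Q * Q ^ (m - 2) with hT
    have h3 : M * (69120 * K ^ 2 + 1) ≤ m.choose 2 * (1080 * N ^ 4 * Q * Q ^ (m - 2)) := h1.trans h2
    have h4 : 2 * m.choose 2 ≤ K ^ 2 * N ^ 2 := by
      have : 2 * m.choose 2 ≤ m * m := by
        rw [Nat.choose_two_right]
        have := Nat.div_mul_le_self (m * (m - 1)) 2
        nlinarith [Nat.sub_le m 1]
      calc 2 * m.choose 2 ≤ m * m := this
        _ ≤ (K * N) * (K * N) := Nat.mul_le_mul hm hm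
        _ = K ^ 2 * N ^ 2 := by ring
    have e1 : 2 * M * (69120 * K ^ 2 + 1) ≤ 2 * m.choose 2 * (1080 * N ^ 4) * T := by
      have := Nat.mul_le_mul_left 2 h3
      have e : 2 * (m.choose 2 * (1080 * N ^ 4 * Q * Q ^ (m - 2))) = 2 * m.choose 2 * (1080 * N ^ 4) * T := by
        rw [hT]; ring
      rw [e] at this
      calc 2 * M * (69120 * K ^ 2 + 1) = 2 * (M * (69120 * K ^ 2 + 1)) := by ring
        _ ≤ _ := this
    have e2 : 2 * m.choose 2 * (1080 * N ^ 4) * T ≤ K ^ 2 * N ^ 2 * (1080 * N ^ 4) * T :=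
      Nat.mul_le_mul_right _ (Nat.mul_le_mul_right _ h4)
    have e3 : K ^ 2 * N ^ 2 * (1080 * N ^ 4) * T = 1080 * K ^ 2 * N ^ 6 * T := by ring
    have e4 : 1080 * K ^ 2 * N ^ 6 * T ≤ 1080 * K ^ 2 * (64 * Q) * T :=
      Nat.mul_le_mul_right _ (Nat.mul_le_mul_left _ hQ6)
    have e5 : 1080 * K ^ 2 * (64 * Q) * T = 69120 * K ^ 2 * (Q * T) := by ring
    have e6 : 69120 * K ^ 2 * (Q * T) ≤ (Q * T) * (69120 * K ^ 2 + 1) := by nlinarith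
    have hfin : 2 * M * (69120 * K ^ 2 + 1) ≤ (Q * T) * (69120 * K ^ 2 + 1) := by
      calc 2 * M * (69120 * K ^ 2 + 1) ≤ 2 * m.choose 2 * (1080 * N ^ 4) * T := e1
        _ ≤ K ^ 2 * N ^ 2 * (1080 * N ^ 4) * T := e2
        _ = 1080 * K ^ 2 * N ^ 6 * T := e3
        _ ≤ 1080 * K ^ 2 * (64 * Q) * T := e4
        _ = 69120 * K ^ 2 * (Q * T) := e5
        _ ≤ (Q * T) * (69120 * K ^ 2 + 1) := e6
    exact Nat.le_of_mul_le_mul_right hfin (by positivity)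

end Summit.PneNP.PneNP.Theorems.IP3OverlapCount
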